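import Literature.NumberTheory.EllipticCurves.DeligneSerreWeightOneAssembly
import Literature.NumberTheory.LFunctions.ChebotarevDensityProofs
import Literature.NumberTheory.Automorphic.DeligneSerreThm46bLeavesProofs
import HarnessLib

/-!
# Deligne–Serre 1974, Thm. 4.1: irreducibility discharged; the weight-one theorem from two leaves

A *proofs* companion (theorems only; no definition, no named fact, nothing restated) to
`Literature.NumberTheory.EllipticCurves.DeligneSerreWeightOneAssembly`, recording what the tree's
discharge of the Chebotarev density theorem over `ℚ`
(`Literature.NumberTheory.LFunctions.Chebotarev.dirichletDensity_eq_holds`,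
`ChebotarevDensityProofs`) does to the decomposition of the named fact
`Literature.NumberTheory.EllipticCurves.ModularForms.exists_complexGaloisRep_of_weight_one`
(`NewformGaloisRep`; Deligne–Serre, *Formes modulaires de poids 1*, Thm. 4.1, p. 513–514, with
§3 (a) and Rem. 4.5: a weight-one newform `f ∈ S_1(Γ₁(N))` has an attached continuous
`ρ : Gal(ℚ̄/ℚ) → GL₂(ℂ)` with finite image, unramified outside `N`, irreducible and odd):

* `DeligneSerre1974.thm41_isIrreducible_holds` — **discharge** of the named fact
  `DeligneSerre1974.thm41_isIrreducible` (`NewformGaloisRepProofs`; op. cit. Thm. 4.1, second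
  assertion: "Cette représentation est irréductible si et seulement si `f` est parabolique",
  for parabolic `f`): the tree's §8.7 argument `thm41_isIrreducible_of`
  (`DeligneSerreWeightOneIrreducible`) fed with Prop. 5.1 (`prop51_holds`), Chebotarev
  (`dirichletDensity_eq_holds`) and the two newform facts
  `IsNewform1.mem_nebentypusSubspace_nebentypus_holds`, `IsNewform1.heckeEigenvalue_eq_coeff_holds`.
* `DeligneSerre1974.exists_complexGaloisRep_of_weight_one_of_thm41_exists` — the weight-one
  theorem from **Thm. 4.1 (existence) alone** (`DeligneSerre1974.thm41_exists`): irreducibility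
  (above) and oddness (`rem45_isOdd_holds`, `DeligneSerreThm46bLeavesProofs`) are now theorems.
* `DeligneSerre1974.exists_complexGaloisRep_of_weight_one_of_thm67_of_span` — the weight-one
  theorem from the **two** deep inputs of the printed proof that the tree does not prove:
  (A) op. cit. Thm. 6.7 in weight one (`DeligneSerre1974.thm67_weightOne`, `NewformGaloisRepModL`;
  behind it Deligne's `λ`-adic representations, Thm. 6.1) and (C) the spanning statement (2.7.2)
  for `S_k(Γ₁(M))`, `k ≥ 2` (`DeligneSerre1974_span_integralLattice1 M k`,
  `NewformGaloisRepIntegralityProofs`; Shimura 1971, Thm. 3.52, op. cit. Rem. 2.8).  This is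
  `exists_complexGaloisRep_of_weight_one_of_leaves₂` with its Chebotarev hypothesis (B) discharged.

So the trust base of `exists_complexGaloisRep_of_weight_one` is exactly {(A), (C)}; equivalently
{`thm41_exists`}.  Its discharge `exists_complexGaloisRep_of_weight_one_holds` is the last theorem
here applied to `thm67_weightOne_holds` and the discharge of (2.7.2) in weights `≥ 2`, once those
exist; no further decomposition of the fact is needed.

## References

* P. Deligne, J.-P. Serre, *Formes modulaires de poids 1*, Ann. Sci. ÉNS (4) 7 (1974), 507–530,
  doi:10.24033/asens.1277: Thm. 4.1 (pp. 513–514), §3 (a) (p. 513), Rem. 4.5 (p. 514), Prop. 2.7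
  and Rem. 2.8 (p. 512), Thm. 6.7 (p. 521), §8.7 (p. 527). [DeligneSerreASENS1974]
-/

noncomputable section

open CongruenceSubgroup

namespace Literature.NumberTheory.EllipticCurves.ModularForms.DeligneSerre1974

variable {N : ℕ} [NeZero N]

/-- **Deligne–Serre 1974, Thm. 4.1, second assertion — discharge of the named fact
`thm41_isIrreducible`.**  For a weight-one newform `f ∈ S_1(Γ₁(N))` (in particular parabolic),
every representation `ρ : Gal(ℚ̄/ℚ) → GL₂(ℂ)` with finite image attached to `f` away from `N`
is irreducible ("Cette représentation est irréductible si et seulement si `f` est parabolique",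
p. 514; proof §8.7: a reducible `ρ` would give `a_p = χ₁(p) + χ₂(p)` and
`∑ |a_p|² p^{-s} ≥ 2 log (1/(s-1)) + O(1)`, contradicting Prop. 5.1).  This is the tree's
`thm41_isIrreducible_of` (`DeligneSerreWeightOneIrreducible`) with all four inputs now proved:
Prop. 5.1 (`prop51_holds`), the Chebotarev density theorem over `ℚ`
(`LFunctions.Chebotarev.dirichletDensity_eq_holds`), and the newform facts
`IsNewform1.mem_nebentypusSubspace_nebentypus_holds`, `IsNewform1.heckeEigenvalue_eq_coeff_holds`.
[cite: DeligneSerreASENS1974, Thm. 4.1 (p. 514) and §8.7] -/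
theorem thm41_isIrreducible_holds : thm41_isIrreducible (N := N) :=
  thm41_isIrreducible_of prop51_holds LFunctions.Chebotarev.dirichletDensity_eq_holds
    IsNewform1.mem_nebentypusSubspace_nebentypus_holds IsNewform1.heckeEigenvalue_eq_coeff_holds

/-- **The Deligne–Serre theorem (Thm. 4.1 with §3 (a) and Rem. 4.5) from Thm. 4.1 (existence)
alone.**  Granted `thm41_exists` — for every newform `f ∈ S_1(Γ₁(N))` a continuous
`ρ : Gal(ℚ̄/ℚ) → GL₂(ℂ)` with finite image attached to `f` away from `N` (op. cit. Thm. 4.1,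
first assertion, §8.1–8.6) — the full statement `exists_complexGaloisRep_of_weight_one`
(irreducible, finite image, odd) follows, irreducibility (`thm41_isIrreducible_holds`, §8.7) and
oddness (`rem45_isOdd_holds`, Rem. 4.4–4.5) being theorems of the tree; the glue is
`exists_complexGaloisRep_of_weight_one_of` (`NewformGaloisRepProofs`).
[cite: DeligneSerreASENS1974, Thm. 4.1 and Rem. 4.5 (pp. 513–514)] -/
theorem exists_complexGaloisRep_of_weight_one_of_thm41_exists (hex : thm41_exists (N := N)) :
    exists_complexGaloisRep_of_weight_one (N := N) :=
  exists_complexGaloisRep_of_weight_one_of hex thm41_isIrreducible_holds rem45_isOdd_holds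

/-- **The Deligne–Serre theorem (Thm. 4.1 with §3 (a) and Rem. 4.5) from its two remaining deep
inputs.**  For every newform `f ∈ S_1(Γ₁(N))` there is a continuous representation
`ρ_f : Gal(ℚ̄/ℚ) → GL₂(ℂ)` attached to `f` away from `N`, irreducible, with finite image and odd
(`exists_complexGaloisRep_of_weight_one`), granted (A) op. cit. Thm. 6.7 in weight one
(`thm67_weightOne`: the mod-`ℓ` representations attached to `f`, p. 521; printed proof 6.8–6.13
from Deligne's Thm. 6.1) and (C) op. cit. (2.7.2) for all levels `M` and weights `k ≥ 2`
(`DeligneSerre1974_span_integralLattice1 M k`: `S_k(Γ₁(M))` is spanned by the forms all of whose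
twists have integral `q`-expansion; Shimura 1971, Thm. 3.52, op. cit. Rem. 2.8 — the weight-one
case is derived from weights `5` and `7`, `DeligneSerre1974_span_integralLattice1.of_two_le`).
This is `exists_complexGaloisRep_of_weight_one_of_leaves₂` (`DeligneSerreWeightOneAssembly`:
§8.2–8.7 with Prop. 5.1, 5.5, 7.2, 2.7, Lemme 3.2, Rem. 4.5 all proved) with its third
hypothesis, the Chebotarev density theorem over `ℚ` (Lemme 8.3, Lemme 3.2), discharged by
`LFunctions.Chebotarev.dirichletDensity_eq_holds`.
[cite: DeligneSerreASENS1974, Thm. 4.1, Rem. 2.8, Rem. 4.5 and Thm. 6.7] -/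
theorem exists_complexGaloisRep_of_weight_one_of_thm67_of_span (h67 : thm67_weightOne (N := N))
    (hL : ∀ (M : ℕ) [NeZero M] (k : ℤ), 2 ≤ k → DeligneSerre1974_span_integralLattice1 M k) :
    exists_complexGaloisRep_of_weight_one (N := N) :=
  exists_complexGaloisRep_of_weight_one_of_leaves₂ h67
    LFunctions.Chebotarev.dirichletDensity_eq_holds hL

end Literature.NumberTheory.EllipticCurves.ModularForms.DeligneSerre1974
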